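import Mathlib
import HarnessLib
import Summits.Ventures.LatticeQCDFlow.Scoring.BlockProdMarginals

/-!
# LatticeQCDFlow / Scoring — the pair-min acceptance statistic on `n` fresh proposals has
# variance `≤ (4n − 6)(1 − acc²)/(n(n − 1)) < 4/n` FOR EVERY FLOW (no weight moment needed)

HONEST FRAMING: exact (Metropolis-corrected) sampling algorithms for lattice gauge theory;
figures of merit are autocorrelation/cost numbers at stated couplings and volumes; no
continuum-physics claim.

Venture `LatticeQCDFlow` (cell pub-lqcd), sub-topic `Scoring`; FANOUT row 3 (`s0-u1-a`, S0-B
implementation A, GEN-7).  NEW WORK of the cell (a product-law factorisation over finite sums and a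
counting step), not a published result; NO definition is introduced.  Companion of row 3's
`Scoring/AcceptanceMonitorUnbiased` (GEN-6: the pair-min numerator is UNBIASED for
`n(n−1)·acc`; "any variance / concentration statement" was listed there as NOT CLAIMED — this file
supplies it for the known-normalisation statistic) and of row 11's `Scoring/IMHAcceptanceFromWeights`
(`acc = E_{q⊗q} min(w, w′)`).  Printed counterpart NAMED ONLY: Hoeffding (1948), the variance of an
order-2 U-statistic.

## Setting (finite configuration space `X`; target `p ≥ 0` normalised; model `q > 0` normalised;
## `w = p/q` with `E_q w = 1`; `n` i.i.d. proposals `φ : Fin n → X`, law `blockProd (fun _ ↦ q)`)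

The statistic is the order-2 U-statistic of the kernel `min(w, w′)` over the `n(n−1)` ordered
off-diagonal pairs,

  `U(φ) = (Σ_{(i,j), i≠j} min(w(φ_i), w(φ_j))) / (n(n−1))`,

i.e. the trainer's `acc_est` numerator evaluated with NORMALISED weights (2-d `U(1)`: the partition
function is exact, `core.u1_2d.exact_torus`, so `w` itself is available from the stored
`log_w = −S + log det J` of every arm-A record set; in 4-d only `c·w` is, and the printed
self-normalised ratio is NOT covered here).

* (from row 3's `Scoring/BlockProdMarginals`, imported) two functions of DISJOINT coordinate
  pairs are uncorrelated: `E[F(φ_i, φ_j)·G(φ_k, φ_l)] = E[F]·E[G]` for pairwise distinct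
  `i, j, k, l` (`sum_blockProd_mul_apply₂_mul_apply₂`);
* `sum_blockProd_mul_min_mul_min_le_one` — for ANY two off-diagonal pairs `(i,j)`, `(k,l)`
  (coincidences allowed): `E[min(w_i,w_j)·min(w_k,w_l)] ≤ 1`, because the product is below
  `w_i·w_l` if `i = k` and below `w_i·w_k` otherwise — in both cases a product over two DISTINCT
  coordinates, of mean `(E_q w)² = 1`; no moment of `w` beyond the first enters;
* `sum_blockProd_mul_offDiag_min` — `E[Σ_{i≠j} min(w_i, w_j)] = n(n−1)·acc` (unbiasedness, in the
  `offDiag` indexing used here);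
* **`variance_pairMin_le`** — `E[(U − acc)²] ≤ (4n − 6)(1 − acc²)/(n(n−1))`: of the `n(n−1)`
  partner pairs of a given pair exactly `(n−2)(n−3)` are disjoint from it (contributing `acc²`
  each to `E[U²]·(n(n−1))²`) and the remaining `4n − 6` contribute at most `1` each;
* **`variance_pairMin_le_four_div`** — `≤ 4(1 − acc²)/n ≤ 4/n`;
* **`chebyshev_pairMin`** — for every `t > 0` the model probability of `|U − acc| ≥ t` is at most
  `4/(n t²)`: a distribution-free, training-state-free error bar for the equilibrium acceptance
  read off `n` fresh proposals (`n = 8 192`: standard error `< 2/√n ≈ 0.0221`;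
  `n = 4×10⁵`: `< 0.0032`), with no chain, no autocorrelation analysis and no assumption on the
  flow.

NOT CLAIMED: anything about the SELF-NORMALISED monitor `acc_est` (ratio; its denominator has
variance `(1/ESS − 1)/n`, unbounded in the flow); any acceptance or error bar of ours; sharpness of
the constant `4` (Hoeffding's exact leading term is `4·ζ₁/n` with `ζ₁ = Var_x E_y min(w_x, w_y) ≤ 1`);
nothing re-scored.
-/

namespace Summit.Ventures.LatticeQCDFlow.Scoring

open Finset
open Literature.Probability.MarkovChains
open Summit.Ventures.LatticeQCDFlow.Exactness
open Summit.Ventures.LatticeQCDFlow.Theory2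

/-! ### The pair-min statistic: mean, second moments, variance -/

section PairMin

variable {X : Type*} [Fintype X] {n : ℕ}

/-- `E_q w = 1` packaged for the iid law: for `i ≠ k`, `E[w(φ_i)·w(φ_k)] = 1`. [folklore] -/
theorem sum_blockProd_mul_weight_mul_weight {p q : X → ℝ} (hq : ∀ x, 0 < q x)
    (hp1 : ∑ x, p x = 1) (hq1 : ∑ x, q x = 1) {i k : Fin n} (hik : i ≠ k) :
    ∑ φ : Fin n → X, blockProd (fun _ => q) φ * (weight p q (φ i) * weight p q (φ k)) = 1 := by
  rw [sum_blockProd_mul_apply_mul_apply (fun _ : Fin n => q) (fun _ => hq1) _ _ hik,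
    sum_mul_weight hq hp1, one_mul]

/-- **Uniform second-moment bound, coincidences allowed.**  For any two off-diagonal pairs
`(i, j)`, `(k, l)` (`i ≠ j`, `k ≠ l`, otherwise arbitrary):
`E[min(w_i, w_j)·min(w_k, w_l)] ≤ 1` — the product is at most `w_i·w_l` when `i = k` (then
`i ≠ l`) and at most `w_i·w_k` otherwise; either way a product over two DISTINCT coordinates, of
mean `(E_q w)² = 1`.  No moment of the weight beyond the first is used. [folklore] -/
theorem sum_blockProd_mul_min_mul_min_le_one {p q : X → ℝ} (hp : ∀ x, 0 ≤ p x)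
    (hq : ∀ x, 0 < q x) (hp1 : ∑ x, p x = 1) (hq1 : ∑ x, q x = 1) {i j k l : Fin n}
    (hij : i ≠ j) (hkl : k ≠ l) :
    ∑ φ : Fin n → X, blockProd (fun _ => q) φ
        * (min (weight p q (φ i)) (weight p q (φ j)) * min (weight p q (φ k)) (weight p q (φ l)))
      ≤ 1 := by
  have hw : ∀ x, 0 ≤ weight p q x := fun x => div_nonneg (hp x) (hq x).le
  have hbp : ∀ φ : Fin n → X, 0 ≤ blockProd (fun _ => q) φ :=
    fun φ => (blockProd_pos (fun _ z => hq z) φ).le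
  have _ := hij
  by_cases hik : i = k
  · subst hik
    -- bound by `w_i · w_l`, `i ≠ l`
    calc _ ≤ ∑ φ : Fin n → X, blockProd (fun _ => q) φ * (weight p q (φ i) * weight p q (φ l)) := by
          refine sum_le_sum fun φ _ => mul_le_mul_of_nonneg_left ?_ (hbp φ)
          exact mul_le_mul (min_le_left _ _) (min_le_right _ _)
            (le_min (hw _) (hw _)) (hw _)
      _ = 1 := sum_blockProd_mul_weight_mul_weight hq hp1 hq1 hkl
  · -- bound by `w_i · w_k`, `i ≠ k`
    calc _ ≤ ∑ φ : Fin n → X, blockProd (fun _ => q) φ * (weight p q (φ i) * weight p q (φ k)) := by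
          refine sum_le_sum fun φ _ => mul_le_mul_of_nonneg_left ?_ (hbp φ)
          exact mul_le_mul (min_le_left _ _) (min_le_left _ _)
            (le_min (hw _) (hw _)) (hw _)
      _ = 1 := sum_blockProd_mul_weight_mul_weight hq hp1 hq1 hik

/-- **Disjoint pairs contribute exactly `acc²`.**  For pairwise distinct `i, j, k, l`:
`E[min(w_i, w_j)·min(w_k, w_l)] = acc(p, q)²`. [folklore] -/
theorem sum_blockProd_mul_min_mul_min_eq_sq {p q : X → ℝ} (hq : ∀ x, 0 < q x)
    (hq1 : ∑ x, q x = 1) {i j k l : Fin n} (hij : i ≠ j) (hik : i ≠ k) (hil : i ≠ l)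
    (hjk : j ≠ k) (hjl : j ≠ l) (hkl : k ≠ l) :
    ∑ φ : Fin n → X, blockProd (fun _ => q) φ
        * (min (weight p q (φ i)) (weight p q (φ j)) * min (weight p q (φ k)) (weight p q (φ l)))
      = accRate p q ^ 2 := by
  rw [sum_blockProd_mul_apply₂_mul_apply₂ (fun _ : Fin n => q) (fun _ => hq1)
    (fun x y => min (weight p q x) (weight p q y)) (fun x y => min (weight p q x) (weight p q y))
    hij hik hil hjk hjl hkl, ← accRate_eq_qq_min_weight hq, sq]

/-- **Unbiasedness in the `offDiag` indexing**: `E[Σ_{(i,j) ∈ offDiag} min(w_i, w_j)] =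
#offDiag · acc(p, q)` (row 3's `sum_blockProd_mul_sum_erase_min` in the indexing used below).
[folklore] -/
theorem sum_blockProd_mul_offDiag_min {p q : X → ℝ} (hq : ∀ x, 0 < q x) (hq1 : ∑ x, q x = 1) :
    ∑ φ : Fin n → X, blockProd (fun _ => q) φ
        * ∑ z ∈ (univ : Finset (Fin n)).offDiag, min (weight p q (φ z.1)) (weight p q (φ z.2))
      = ((univ : Finset (Fin n)).offDiag.card : ℝ) * accRate p q := by
  simp_rw [mul_sum]
  rw [sum_comm]
  have h : ∀ z ∈ (univ : Finset (Fin n)).offDiag, ∑ φ : Fin n → X, blockProd (fun _ => q) φ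
      * min (weight p q (φ z.1)) (weight p q (φ z.2)) = accRate p q := by
    intro z hz
    rw [sum_blockProd_mul_apply₂ (fun _ : Fin n => q) (fun _ => hq1)
      (fun x y => min (weight p q x) (weight p q y)) (mem_offDiag.mp hz).2.2,
      accRate_eq_qq_min_weight hq]
  rw [sum_congr rfl h, sum_const, nsmul_eq_mul]

/-- The partner pairs DISJOINT from `(i, j)`: the off-diagonal pairs of `univ \ {i, j}`; there are
exactly `(n − 2)(n − 3)` of them, and `4n − 6` others. -/
theorem card_offDiag_sdiff_pair {i j : Fin n} (hij : i ≠ j) :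
    (((univ : Finset (Fin n)) \ {i, j}).offDiag.card : ℝ) = (n - 2) * (n - 3) ∧
    (((univ : Finset (Fin n)).offDiag \ ((univ : Finset (Fin n)) \ {i, j}).offDiag).card : ℝ)
      = 4 * n - 6 := by
  have hn : 2 ≤ n := by
    have : ({i, j} : Finset (Fin n)).card ≤ (univ : Finset (Fin n)).card := card_le_card (subset_univ _)
    rw [card_pair hij, card_univ, Fintype.card_fin] at this
    exact this
  have hc2 : ((univ : Finset (Fin n)) \ {i, j}).card = n - 2 := by
    rw [card_sdiff_of_subset (subset_univ _), card_univ, Fintype.card_fin, card_pair hij]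
  have hsub : ((univ : Finset (Fin n)) \ {i, j}).offDiag ⊆ (univ : Finset (Fin n)).offDiag := by
    intro z hz
    rw [mem_offDiag] at hz ⊢
    exact ⟨mem_univ _, mem_univ _, hz.2.2⟩
  have hD : ((univ : Finset (Fin n)) \ {i, j}).offDiag.card = (n - 2) * (n - 2) - (n - 2) := by
    rw [offDiag_card, hc2]
  have hO : (univ : Finset (Fin n)).offDiag.card = n * n - n := by
    rw [offDiag_card, card_univ, Fintype.card_fin]
  obtain ⟨m, rfl⟩ := Nat.exists_eq_add_of_le hn
  have e1 : (2 + m - 2) * (2 + m - 2) - (2 + m - 2) = m * m - m := by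
    rw [show 2 + m - 2 = m by omega]
  constructor
  · rw [hD, e1, Nat.cast_sub (Nat.le_mul_self m), Nat.cast_mul, Nat.cast_add]
    push_cast
    ring
  · rw [card_sdiff_of_subset hsub, hO, hD, e1]
    have h1 : m * m - m ≤ (2 + m) * (2 + m) - (2 + m) := by
      have : m ≤ m * m := Nat.le_mul_self m
      have : (2 + m) * (2 + m) - (2 + m) = m * m + 3 * m + 2 := by
        rw [show (2 + m) * (2 + m) = m * m + 3 * m + 2 + (2 + m) by ring, Nat.add_sub_cancel]
      omega
    rw [Nat.cast_sub h1, Nat.cast_sub (Nat.le_mul_self _), Nat.cast_sub (Nat.le_mul_self _)]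
    push_cast
    ring

/-- **The variance of the pair-min statistic.**  For a normalised target `p ≥ 0`, a positive
normalised model `q`, `w = p/q`, and `n ≥ 2` i.i.d. proposals:
`E[(U − acc)²] ≤ (4n − 6)·(1 − acc²)/(n(n − 1))` where
`U = (Σ_{i≠j} min(w_i, w_j))/(n(n−1))` and `acc = acc(p, q)` is its mean.  Of the `n(n−1)`
partner pairs of a pair, the `(n−2)(n−3)` disjoint ones contribute exactly `acc²` to `E[U²]` and the
other `4n − 6` at most `1`. [folklore] -/
theorem variance_pairMin_le {p q : X → ℝ} (hp : ∀ x, 0 ≤ p x) (hq : ∀ x, 0 < q x)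
    (hp1 : ∑ x, p x = 1) (hq1 : ∑ x, q x = 1) (hn : 2 ≤ n) :
    ∑ φ : Fin n → X, blockProd (fun _ => q) φ
        * ((∑ z ∈ (univ : Finset (Fin n)).offDiag, min (weight p q (φ z.1)) (weight p q (φ z.2)))
            / (n * (n - 1)) - accRate p q) ^ 2
      ≤ (4 * n - 6) * (1 - accRate p q ^ 2) / (n * (n - 1)) := by
  classical
  set O : Finset (Fin n × Fin n) := (univ : Finset (Fin n)).offDiag with hOdef
  set h : (Fin n × Fin n) → (Fin n → X) → ℝ :=
    fun z φ => min (weight p q (φ z.1)) (weight p q (φ z.2)) with hhdef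
  set a := accRate p q with hadef
  have hNpos : (0 : ℝ) < n * (n - 1) := by
    have h2 : (2 : ℝ) ≤ n := by exact_mod_cast hn
    have : (0 : ℝ) < n := by linarith
    have : (0 : ℝ) < n - 1 := by linarith
    positivity
  have hOcard : (O.card : ℝ) = n * (n - 1) := by
    rw [hOdef, offDiag_card, card_univ, Fintype.card_fin, Nat.cast_sub (Nat.le_mul_self n)]
    push_cast; ring
  have hbp1 : ∑ φ : Fin n → X, blockProd (fun _ => q) φ = 1 := by
    rw [sum_blockProd]; simp [hq1]
  -- mean
  have hmean : ∑ φ : Fin n → X, blockProd (fun _ => q) φ * ∑ z ∈ O, h z φ = n * (n - 1) * a := by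
    rw [← hOcard]; exact sum_blockProd_mul_offDiag_min hq hq1
  -- second moment bound
  have hsecond : ∑ φ : Fin n → X, blockProd (fun _ => q) φ * (∑ z ∈ O, h z φ) ^ 2
      ≤ n * (n - 1) * ((n - 2) * (n - 3) * a ^ 2 + (4 * n - 6)) := by
    have hexp : ∀ φ : Fin n → X, blockProd (fun _ => q) φ * (∑ z ∈ O, h z φ) ^ 2
        = ∑ z ∈ O, ∑ z' ∈ O, blockProd (fun _ => q) φ * (h z φ * h z' φ) := by
      intro φ
      rw [sq, sum_mul_sum, mul_sum]
      exact sum_congr rfl fun z _ => mul_sum _ _ _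
    simp_rw [hexp]
    rw [sum_comm]
    have hz : ∀ z ∈ O, ∑ φ : Fin n → X, ∑ z' ∈ O, blockProd (fun _ => q) φ * (h z φ * h z' φ)
        ≤ (n - 2) * (n - 3) * a ^ 2 + (4 * n - 6) := by
      intro z hzO
      rw [sum_comm]
      obtain ⟨-, -, hij⟩ := mem_offDiag.mp hzO
      set D : Finset (Fin n × Fin n) := ((univ : Finset (Fin n)) \ {z.1, z.2}).offDiag with hDdef
      have hDsub : D ⊆ O := by
        intro z' hz'
        rw [hDdef, mem_offDiag] at hz'
        rw [hOdef, mem_offDiag]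
        exact ⟨mem_univ _, mem_univ _, hz'.2.2⟩
      obtain ⟨hDcard, hRcard⟩ := card_offDiag_sdiff_pair hij
      rw [← sum_sdiff hDsub]
      -- disjoint partners: exactly `acc²` each
      have hDsum : ∑ z' ∈ D, ∑ φ : Fin n → X, blockProd (fun _ => q) φ * (h z φ * h z' φ)
          = (n - 2) * (n - 3) * a ^ 2 := by
        have hterm : ∀ z' ∈ D, ∑ φ : Fin n → X, blockProd (fun _ => q) φ * (h z φ * h z' φ)
            = a ^ 2 := by
          intro z' hz'
          rw [hDdef, mem_offDiag, mem_sdiff, mem_sdiff, mem_insert, mem_singleton, mem_insert,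
            mem_singleton] at hz'
          obtain ⟨⟨-, hk⟩, ⟨-, hl⟩, hkl⟩ := hz'
          obtain ⟨hk1, hk2⟩ := not_or.mp hk
          obtain ⟨hl1, hl2⟩ := not_or.mp hl
          exact sum_blockProd_mul_min_mul_min_eq_sq hq hq1 hij (Ne.symm hk1) (Ne.symm hl1)
            (Ne.symm hk2) (Ne.symm hl2) hkl
        rw [sum_congr rfl hterm, sum_const, nsmul_eq_mul, hDdef, hDcard]
      -- the other `4n − 6` partners: at most `1` each
      have hRsum : ∑ z' ∈ O \ D, ∑ φ : Fin n → X, blockProd (fun _ => q) φ * (h z φ * h z' φ)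
          ≤ 4 * n - 6 := by
        have hterm : ∀ z' ∈ O \ D, ∑ φ : Fin n → X, blockProd (fun _ => q) φ * (h z φ * h z' φ)
            ≤ 1 := by
          intro z' hz'
          have hkl := (mem_offDiag.mp (mem_sdiff.mp hz').1).2.2
          exact sum_blockProd_mul_min_mul_min_le_one hp hq hp1 hq1 hij hkl
        calc _ ≤ ∑ z' ∈ O \ D, (1 : ℝ) := sum_le_sum hterm
          _ = ((O \ D).card : ℝ) := by rw [sum_const, nsmul_eq_mul, mul_one]
          _ = 4 * n - 6 := by rw [hOdef, hDdef]; exact hRcard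
      rw [hDsum]
      linarith
    calc ∑ z ∈ O, ∑ φ : Fin n → X, ∑ z' ∈ O, blockProd (fun _ => q) φ * (h z φ * h z' φ)
        ≤ ∑ z ∈ O, ((n - 2) * (n - 3) * a ^ 2 + (4 * n - 6)) := sum_le_sum hz
      _ = n * (n - 1) * ((n - 2) * (n - 3) * a ^ 2 + (4 * n - 6)) := by
          rw [sum_const, nsmul_eq_mul, hOcard]
  -- assemble: `E[(S/N − a)²] = (E[S²] − (N a)²)/N²`
  have h2 : (2 : ℝ) ≤ n := by exact_mod_cast hn
  have hn0 : (n : ℝ) ≠ 0 := by positivity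
  have hn1 : (n : ℝ) - 1 ≠ 0 := (by linarith : (0 : ℝ) < n - 1).ne'
  have hsq : ∀ φ : Fin n → X, blockProd (fun _ => q) φ
      * ((∑ z ∈ O, h z φ) / (n * (n - 1)) - a) ^ 2
      = (blockProd (fun _ => q) φ * (∑ z ∈ O, h z φ) ^ 2
          - 2 * (n * (n - 1) * a) * (blockProd (fun _ => q) φ * ∑ z ∈ O, h z φ)
          + (n * (n - 1) * a) ^ 2 * blockProd (fun _ => q) φ) / (n * (n - 1)) ^ 2 := by
    intro φ
    field_simp
    ring
  have hnum : ∑ φ : Fin n → X, (blockProd (fun _ => q) φ * (∑ z ∈ O, h z φ) ^ 2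
          - 2 * (n * (n - 1) * a) * (blockProd (fun _ => q) φ * ∑ z ∈ O, h z φ)
          + (n * (n - 1) * a) ^ 2 * blockProd (fun _ => q) φ)
      = (∑ φ : Fin n → X, blockProd (fun _ => q) φ * (∑ z ∈ O, h z φ) ^ 2)
          - (n * (n - 1) * a) ^ 2 := by
    rw [sum_add_distrib, sum_sub_distrib, ← mul_sum, ← mul_sum, hmean, hbp1]
    ring
  show ∑ φ : Fin n → X, blockProd (fun _ => q) φ
      * ((∑ z ∈ O, h z φ) / (n * (n - 1)) - a) ^ 2 ≤ (4 * n - 6) * (1 - a ^ 2) / (n * (n - 1))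
  calc ∑ φ : Fin n → X, blockProd (fun _ => q) φ * ((∑ z ∈ O, h z φ) / (n * (n - 1)) - a) ^ 2
      = ((∑ φ : Fin n → X, blockProd (fun _ => q) φ * (∑ z ∈ O, h z φ) ^ 2)
          - (n * (n - 1) * a) ^ 2) / (n * (n - 1)) ^ 2 := by
        simp_rw [hsq]
        rw [← sum_div, hnum]
    _ ≤ (n * (n - 1) * ((n - 2) * (n - 3) * a ^ 2 + (4 * n - 6)) - (n * (n - 1) * a) ^ 2)
          / (n * (n - 1)) ^ 2 :=
        div_le_div_of_nonneg_right (sub_le_sub_right hsecond _) (sq_nonneg _)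
    _ = (4 * n - 6) * (1 - a ^ 2) / (n * (n - 1)) := by
        field_simp
        ring

/-- **`Var(U) ≤ 4(1 − acc²)/n ≤ 4/n`** — the clean form (`(4n − 6)/(n − 1) ≤ 4`). [folklore] -/
theorem variance_pairMin_le_four_div {p q : X → ℝ} (hp : ∀ x, 0 ≤ p x) (hq : ∀ x, 0 < q x)
    (hp1 : ∑ x, p x = 1) (hq1 : ∑ x, q x = 1) (hn : 2 ≤ n) :
    ∑ φ : Fin n → X, blockProd (fun _ => q) φ
        * ((∑ z ∈ (univ : Finset (Fin n)).offDiag, min (weight p q (φ z.1)) (weight p q (φ z.2)))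
            / (n * (n - 1)) - accRate p q) ^ 2
      ≤ 4 * (1 - accRate p q ^ 2) / n ∧ 4 * (1 - accRate p q ^ 2) / n ≤ 4 / n := by
  classical
  have h2 : (2 : ℝ) ≤ n := by exact_mod_cast hn
  have hnpos : (0 : ℝ) < n := by linarith
  have hn1 : (0 : ℝ) < n - 1 := by linarith
  have ha0 : 0 ≤ accRate p q := by
    unfold accRate
    exact sum_nonneg fun x _ => sum_nonneg fun y _ =>
      le_min (mul_nonneg (hp x) (hq y).le) (mul_nonneg (hp y) (hq x).le)
  have ha1 : accRate p q ≤ 1 :=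
    (accRate_le hp1 hq1).trans (sub_le_self _ (tvDist_nonneg _ _))
  have h1a : 0 ≤ 1 - accRate p q ^ 2 := by nlinarith
  constructor
  · refine (variance_pairMin_le hp hq hp1 hq1 hn).trans ?_
    rw [div_le_div_iff₀ (mul_pos hnpos hn1) hnpos]
    nlinarith
  · exact div_le_div_of_nonneg_right (by nlinarith) hnpos.le

/-- **Chebyshev: a distribution-free error bar for the acceptance read off `n` fresh proposals.**
For every `t > 0`, the model probability that the pair-min statistic misses the equilibrium
acceptance by `t` or more is at most `4/(n t²)` — for EVERY flow, trained or not, with no moment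
assumption on the weights. [folklore] -/
theorem chebyshev_pairMin {p q : X → ℝ} (hp : ∀ x, 0 ≤ p x) (hq : ∀ x, 0 < q x)
    (hp1 : ∑ x, p x = 1) (hq1 : ∑ x, q x = 1) (hn : 2 ≤ n) {t : ℝ} (ht : 0 < t) :
    ∑ φ ∈ (univ : Finset (Fin n → X)).filter (fun φ => t ≤
        |(∑ z ∈ (univ : Finset (Fin n)).offDiag, min (weight p q (φ z.1)) (weight p q (φ z.2)))
            / (n * (n - 1)) - accRate p q|), blockProd (fun _ => q) φ
      ≤ 4 / (n * t ^ 2) := by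
  classical
  set U : (Fin n → X) → ℝ := fun φ =>
    (∑ z ∈ (univ : Finset (Fin n)).offDiag, min (weight p q (φ z.1)) (weight p q (φ z.2)))
      / (n * (n - 1)) - accRate p q with hUdef
  have hbp : ∀ φ : Fin n → X, 0 ≤ blockProd (fun _ => q) φ :=
    fun φ => (blockProd_pos (fun _ z => hq z) φ).le
  have hvar : ∑ φ : Fin n → X, blockProd (fun _ => q) φ * U φ ^ 2 ≤ 4 / n :=
    (variance_pairMin_le_four_div hp hq hp1 hq1 hn).1.trans
      (variance_pairMin_le_four_div hp hq hp1 hq1 hn).2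
  have ht2 : 0 < t ^ 2 := pow_pos ht 2
  -- indicator ≤ U²/t² on the event
  have hind : ∑ φ ∈ univ.filter (fun φ => t ≤ |U φ|), blockProd (fun _ => q) φ
      ≤ ∑ φ ∈ univ.filter (fun φ => t ≤ |U φ|), blockProd (fun _ => q) φ * (U φ ^ 2 / t ^ 2) := by
    refine sum_le_sum fun φ hφ => ?_
    have hle : t ≤ |U φ| := (mem_filter.mp hφ).2
    have : 1 ≤ U φ ^ 2 / t ^ 2 := by
      rw [le_div_iff₀ ht2, one_mul, ← sq_abs (U φ)]
      exact pow_le_pow_left₀ ht.le hle 2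
    calc blockProd (fun _ => q) φ = blockProd (fun _ => q) φ * 1 := (mul_one _).symm
      _ ≤ blockProd (fun _ => q) φ * (U φ ^ 2 / t ^ 2) := mul_le_mul_of_nonneg_left this (hbp φ)
  have hall : ∑ φ ∈ univ.filter (fun φ => t ≤ |U φ|), blockProd (fun _ => q) φ * (U φ ^ 2 / t ^ 2)
      ≤ ∑ φ : Fin n → X, blockProd (fun _ => q) φ * (U φ ^ 2 / t ^ 2) :=
    sum_le_sum_of_subset_of_nonneg (filter_subset _ _)
      (fun φ _ _ => mul_nonneg (hbp φ) (div_nonneg (sq_nonneg _) ht2.le))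
  have hscale : ∑ φ : Fin n → X, blockProd (fun _ => q) φ * (U φ ^ 2 / t ^ 2)
      = (∑ φ : Fin n → X, blockProd (fun _ => q) φ * U φ ^ 2) / t ^ 2 := by
    rw [sum_div]
    exact sum_congr rfl fun φ _ => by ring
  calc _ ≤ _ := hind
    _ ≤ _ := hall
    _ = _ := hscale
    _ ≤ (4 / n) / t ^ 2 := div_le_div_of_nonneg_right hvar ht2.le
    _ = 4 / (n * t ^ 2) := by rw [div_div]

end PairMin

end Summit.Ventures.LatticeQCDFlow.Scoring
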